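/-
Copyright: pub-balaban β-flow team, β-FLOW PROVER 3 (unit `b2b-balaban-beta-bflow-p3`, gen 7; coordinator ruling «YM ACCELERATION»
2026-08-21 item (2), «work behind the as-printed interface»).  Lattice bookkeeping over [B7]'s contour words + one explicit abelian
configuration ([folklore]); nothing of Bałaban's model asserted; NOT BetaPertH, NOT continuum, NOT Clay.
-/
import Mathlib
import Literature.MathematicalPhysics.QuantumFieldTheory.Balaban1983to89.B7Prop1Explicit

/-!
# Erice §III.3 (3.47) ∕ (3.49): A CURVATURE BOUND DOES NOT GIVE A NO-LOG BONDWISE BOUND ON ANY GAUGE REPRESENTATIVE — the kernel witness behind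
# MODULE 18 `Beta.EricePreGauge347`'s located reading of the Ψ-road ENDs' pre-gauge binder `h352''`

HONEST FRAMING (page 1 of everything): [folklore] lattice gauge bookkeeping on `ℤ^d` in the letters of the tree's [B7] record
`B7Prop1Explicit` (`hol`, `seg`, `rectWord`, `plaqWord`, `gaugeAct`, `U1`) and ONE explicit abelian configuration on `ℤ²`; no object of
[BalabanJaffe1986] ∕ [Balaban1987RG1] is instantiated; NOT (3.47) for the model, NOT B12 Thm 2, NOT BetaPertH, NOT continuum, NOT Clay.
HONEST DEPENDENCY: continuum YM on T⁴ ⇐ BetaPertH ∧ nine spine estimates (0/9 proved); BetaPertH ⇐ (D1) ∧ (D4) ∧ CAP+tail; G-an2-4 gates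
asym, D1 and NE2/3/4.

CITATION HEADER.  T. Bałaban, A. Jaffe, «Constructive gauge theory» (Erice 1985), NATO ASI B **141**, Plenum 1986, pp. 207–263 [BalabanJaffe1986],
Part III p. 246 (3.47) «|∂V′ − I| < 2δ(L^jη)²», (3.48), p. 247 (3.49) «|V″(x,x′) − I| ≤ 2δ dist(⟨x,x′⟩,y) (L^jη)² ≤ 60dκ^{−1} q(δ,L^jη)(L^jη)²»,
(3.51)–(3.52) (bank `HOME/beta/ERICE-STATEMENT.md` §B); T. Bałaban, «Averaging operations for lattice gauge theories», CMP **98** (1985) 17–51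
[Balaban1985Averaging] p. 25 «|V₀,b − 1| < |b₋ − y|α₀» (tree `B7Prop1Explicit.axial_bond_bound`).  β-flow team PROVER 3 gen 7; MODULE 18b,
sibling of MODULE 18 `Beta.EricePreGauge347` (the END of print's direct road with (3.47) as the field-size input).

WHY THIS MODULE.  The axial-gauge-map ENDs of the β-flow series (bflow-p4 PART 12b → 14c ∕ 16; this lineage's MODULES 9–13c, 17–17c) take a
PRE-GAUGE 𝔤-valued field `Bg_{j,X}` on the bonds of the cube □₂ (side 3M₁, M₁ = [20κ⁻¹q(1,L^jη)]) with `h352'' : ‖Bg_{j,X}‖ ≤ C₁″·δ·(L^jη)²`, ONE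
constant C₁″ for all steps j — worded in the S41 supply as «the PRE-GAUGE bound in curvature-size form (no logarithm — the size of (3.47))».
Print controls its pre-gauge object V′ = Ū^j_n(V) ONLY IN CURVATURE ((3.47)) and derives the bondwise size (3.49) ∕ (3.52) — WITH the factor
dist(⟨x,x′⟩, y) ≤ 3dM₁∕2, i.e. the logarithm — for the axial-gauged V″.  THIS FILE is the kernel witness that the logarithm cannot be removed
by ANY choice of gauge: on `ℤ²` with G = U(1) ⊂ ℂ, for every k ≥ 1 the configuration V_k (V_k(x, x+e₀) = 1, V_k(x, x+e₁) = u^{x₀},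
u = e^{iπ∕k²}) has EVERY plaquette variable within π∕k² of 1, while for EVERY U(1)-valued lattice gauge function g some bond of the square
[0,k]² has ‖V_k^g(b) − 1‖ ≥ 1∕(2k) = (k∕(2π))·(π∕k²): the holonomy of V_k^g around ∂[0,k]² is that of V_k (abelian), = u^{k²} = e^{iπ} = −1, at
distance 2 from 1, and it is a product of 4k bond variables of modulus 1.  Read at Erice's □₂ (k = 3M₁(j) → ∞ as L^jη → 0): a bound
‖log V′^g‖ ≤ C·δ(L^jη)² on □₂ for some gauge representative of a field obeying (3.47) forces C ≥ 3M₁(j)∕(2π) (with ‖W − 1‖ ≤ 2‖log W‖ for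
‖log W‖ ≤ 1) — no j-uniform C₁″ exists; the
no-log `h352''` is a located NOT-IN-PRINT representability premise, not a consequence of (3.47).  (MODULE 18's END takes (3.47) itself and keeps
print's logarithm inside B = log V″.)

WHAT THIS MODULE PROVES (kernel-checked, 0 sorry, 0 def).  §1 abelian holonomies in [B7]'s letters (any commutative group): `hol_seg_natCast_eq_prod`,
`hol_seg_neg_natCast`, `hol_rectWord_eq` (the boundary holonomy of the n × m rectangle as bottom·right·top⁻¹·left⁻¹), `hol_rectWord_gaugeAct`
(gauge INVARIANCE of a closed abelian holonomy), `hol_plaqWord_eq` (any group).  §2 the U1 telescoping estimates ‖ab − 1‖ ≤ ‖a − 1‖ + ‖b − 1‖,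
‖∏ − 1‖ ≤ Σ‖· − 1‖ (`norm_units_mul_sub_one_le`, `norm_prod_sub_one_le_sum`, `prod_mem_U1`).  §3 THE WITNESS **`curvature_small_no_bondwise_gauge`**:
∀ k ≥ 1 ∃ V : ℤ² → U(1) with all plaquettes ‖V(∂p) − 1‖ ≤ π∕k² such that every U1-valued gauge function g has a bond ⟨x, x+e_μ⟩, x ∈ [0,k]², with
1∕(2k) ≤ ‖V^g(x, x+e_μ) − 1‖; and its reading for Lie-algebra variables `no_uniform_pregauge_constant` (no C with ‖V^g(b) − 1‖ ≤ C·(plaquette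
bound) on [0,k]² for all k: C ≥ k∕(2π) is forced).

DECLARED DIVERGENCES ∕ NOT HERE.  d = 2 inside ℤ⁴ (a configuration constant in the other directions gives the same count), G = U(1) (the centre
direction of U(N) carries the same abelian configuration; print's G is semisimple — SU(N) contains the U(1) of diag(e^{iφ}, e^{−iφ}, 1, …),
on which the same configuration lives: not typed here); nothing about Bałaban's V′ is claimed — the witness concerns what (3.47) ALONE allows.
INDEPENDENT TWIN (same verdict, same hour, other letters): bflow-p4 g7's PART 18 `Beta.EriceAxialGaugePreGaugeNecessity` (staged twin
2c316b729ca3e8b6) is the ADDITIVE (logarithmic-coordinate) Stokes record in the letters M₁(j), q(1,L^jη) of (3.48) — a constant curl of the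
size (3.47) allows on an M₁ × M₁ square forces M₁(j) ≤ 4C₁″, so `h352''` excludes such backgrounds at every step but the last O(1); this file
is the MULTIPLICATIVE U(1) record from (3.47)'s side (holonomy −1 on [0,k]², every gauge representative).
-/

namespace Summit.QuantumFields.BalabanUV.Beta.EricePreGauge347Witness

open Literature.MathematicalPhysics.QuantumFieldTheory.Balaban1983to89.B7Prop1Explicit
open scoped BigOperators

/-! ## §1. Abelian holonomies in [B7]'s letters: segments, the rectangle boundary, gauge invariance, the plaquette -/

section Holonomy

variable {d : ℕ}

/-- The plaquette holonomy spelled out (any group): `V(∂p_{x;κ,μ}) = V(x,κ)·V(x+e_κ,μ)·V(x+e_μ,κ)⁻¹·V(x,μ)⁻¹`. [folklore] -/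
theorem hol_plaqWord_eq {G : Type*} [Group G] (V : Site d → Fin d → G) (x : Site d) (κ μ : Fin d) :
    hol V x (plaqWord κ μ) = V x κ * V (x + e κ) μ * (V (x + e μ) κ)⁻¹ * (V x μ)⁻¹ := by
  simp only [plaqWord, hol_cons, hol_nil, stepHol_true, stepHol_false, Letter.vec_true, Letter.vec_false, mul_one,
    mul_assoc]
  rw [show x + e κ + e μ - e κ = x + e μ by abel, show x + e κ + e μ + -e κ - e μ = x by abel]

/-- Transport along the straight segment of `n` forward steps is the ordered product of the `n` bond variables; in a commutative group,
`V([z, z + n e_κ]) = ∏_{i<n} V(z + i e_κ, κ)`. [folklore] -/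
theorem hol_seg_natCast_eq_prod {G : Type*} [CommGroup G] (V : Site d → Fin d → G) (z : Site d) (κ : Fin d) :
    ∀ n : ℕ, hol V z (seg κ (n : ℤ)) = ∏ i ∈ Finset.range n, V (z + (i : ℤ) • e κ) κ
  | 0 => by simp
  | n + 1 => by
    rw [show ((n + 1 : ℕ) : ℤ) = (n : ℤ) + 1 by push_cast; rfl, hol_seg_natCast_succ, hol_seg_natCast_eq_prod V z κ n,
      Finset.prod_range_succ]

/-- Transport along a backward segment is the inverse of the forward transport from its endpoint (any group). [folklore] -/
theorem hol_seg_neg_natCast {G : Type*} [Group G] (V : Site d → Fin d → G) (p : Site d) (κ : Fin d) (n : ℕ) :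
    hol V p (seg κ (-(n : ℤ))) = (hol V (p - (n : ℤ) • e κ) (seg κ (n : ℤ)))⁻¹ := by
  rw [← revWord_seg]
  exact hol_revWord' V (x := p - (n : ℤ) • e κ) p (seg κ (n : ℤ)) (by rw [disp_seg]; abel)

/-- **The boundary holonomy of the `n × m` rectangle** with lower-left corner `p`, spanned by `e_μ, e_ν`, in a commutative group:
bottom · right · top⁻¹ · left⁻¹, each side the product of its bond variables. [folklore] -/
theorem hol_rectWord_eq {G : Type*} [CommGroup G] (V : Site d → Fin d → G) (p : Site d) (n m : ℕ) (μ ν : Fin d) :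
    hol V p (rectWord n m μ ν) =
      (∏ i ∈ Finset.range n, V (p + (i : ℤ) • e μ) μ) * (∏ j ∈ Finset.range m, V (p + (n : ℤ) • e μ + (j : ℤ) • e ν) ν) *
        (∏ i ∈ Finset.range n, V (p + (i : ℤ) • e μ + (m : ℤ) • e ν) μ)⁻¹ * (∏ j ∈ Finset.range m, V (p + (j : ℤ) • e ν) ν)⁻¹ := by
  rw [rectWord, hol_append, hol_append, hol_append]
  simp only [disp_append, disp_seg]
  rw [hol_seg_natCast_eq_prod, hol_seg_natCast_eq_prod, hol_seg_neg_natCast, hol_seg_neg_natCast, hol_seg_natCast_eq_prod,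
    hol_seg_natCast_eq_prod]
  have e3 : p + ((n : ℤ) • e μ + (m : ℤ) • e ν) - (n : ℤ) • e μ = p + (m : ℤ) • e ν := by abel
  have e4 : p + ((n : ℤ) • e μ + (m : ℤ) • e ν + (-(n : ℤ)) • e μ) - (m : ℤ) • e ν = p := by rw [neg_smul]; abel
  rw [e3, e4]
  congr 2
  refine congrArg _ (Finset.prod_congr rfl fun i _ => ?_)
  rw [show p + (m : ℤ) • e ν + (i : ℤ) • e μ = p + (i : ℤ) • e μ + (m : ℤ) • e ν by abel]

/-- The rectangle contour is closed. [folklore] -/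
@[simp] theorem disp_rectWord (n m : ℕ) (μ ν : Fin d) : disp (rectWord n m μ ν : List (Letter d)) = 0 := by
  simp only [rectWord, disp_append, disp_seg, neg_smul]
  abel

/-- **Gauge invariance of a closed abelian holonomy**: in a commutative group the boundary holonomy of the rectangle is unchanged by every
lattice gauge transformation `V ↦ V^g` ([B7] (8): `V^g(Γ) = g(Γ₋)V(Γ)g(Γ₊)⁻¹`, `Γ₋ = Γ₊` for a closed contour). [folklore] -/
theorem hol_rectWord_gaugeAct {G : Type*} [CommGroup G] (g : Site d → G) (V : Site d → Fin d → G) (p : Site d) (n m : ℕ) (μ ν : Fin d) :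
    hol (gaugeAct g V) p (rectWord n m μ ν) = hol V p (rectWord n m μ ν) := by
  rw [hol_gaugeAct_closed g V p _ (disp_rectWord n m μ ν), mul_comm (g p), mul_inv_cancel_right]

end Holonomy

/-! ## §2. The U1 telescoping estimates -/

section Telescoping

variable {𝕜 : Type*} [NormedCommRing 𝕜]

/-- `‖ab − 1‖ ≤ ‖a − 1‖ + ‖b − 1‖` for `‖a‖ ≤ 1` (`ab − 1 = a(b − 1) + (a − 1)`). [folklore] -/
theorem norm_mul_sub_one_le_of_norm_le_one {a b : 𝕜} (ha : ‖a‖ ≤ 1) : ‖a * b - 1‖ ≤ ‖a - 1‖ + ‖b - 1‖ := by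
  have h : a * b - 1 = a * (b - 1) + (a - 1) := by rw [mul_sub, mul_one, sub_add_sub_cancel]
  rw [h]
  calc ‖a * (b - 1) + (a - 1)‖ ≤ ‖a * (b - 1)‖ + ‖a - 1‖ := norm_add_le _ _
    _ ≤ ‖a‖ * ‖b - 1‖ + ‖a - 1‖ := by gcongr; exact norm_mul_le _ _
    _ ≤ 1 * ‖b - 1‖ + ‖a - 1‖ := by gcongr
    _ = ‖a - 1‖ + ‖b - 1‖ := by ring

variable [NormOneClass 𝕜]

/-- The same for units in `U1`: `‖uv − 1‖ ≤ ‖u − 1‖ + ‖v − 1‖`. [folklore] -/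
theorem norm_units_mul_sub_one_le {u v : 𝕜ˣ} (hu : u ∈ U1 𝕜) :
    ‖((u * v : 𝕜ˣ) : 𝕜) - 1‖ ≤ ‖(u : 𝕜) - 1‖ + ‖(v : 𝕜) - 1‖ := by
  rw [Units.val_mul]
  exact norm_mul_sub_one_le_of_norm_le_one hu.1

/-- A finite product of `U1`-units is in `U1`. [folklore] -/
theorem prod_mem_U1 (f : ℕ → 𝕜ˣ) (hf : ∀ i, f i ∈ U1 𝕜) (n : ℕ) : (∏ i ∈ Finset.range n, f i) ∈ U1 𝕜 :=
  Subgroup.prod_mem _ fun i _ => hf i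

/-- **Telescoping**: `‖∏_{i<n} f i − 1‖ ≤ Σ_{i<n} ‖f i − 1‖` for `U1`-valued `f`. [folklore] -/
theorem norm_prod_sub_one_le_sum (f : ℕ → 𝕜ˣ) (hf : ∀ i, f i ∈ U1 𝕜) :
    ∀ n : ℕ, ‖((∏ i ∈ Finset.range n, f i : 𝕜ˣ) : 𝕜) - 1‖ ≤ ∑ i ∈ Finset.range n, ‖(f i : 𝕜) - 1‖
  | 0 => by simp
  | n + 1 => by
    rw [Finset.prod_range_succ, Finset.sum_range_succ]
    exact (norm_units_mul_sub_one_le (prod_mem_U1 f hf n)).trans (by gcongr; exact norm_prod_sub_one_le_sum f hf n)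

end Telescoping

/-! ## §3. The witness on `ℤ²`, G = U(1) ⊂ ℂ -/

section Witness

/-- A unit of `ℂ` of modulus one lies in `U1 ℂ` (‖u⁻¹‖ = ‖u‖⁻¹ = 1). [folklore] -/
theorem mem_U1_of_norm_eq_one {u : ℂˣ} (hu : ‖(u : ℂ)‖ = 1) : u ∈ U1 ℂ := by
  refine ⟨hu.le, ?_⟩
  rw [Units.val_inv_eq_inv_val, norm_inv, hu, inv_one]

/-- **THE WITNESS: a curvature bound gives no cube-uniform bondwise bound on any gauge representative.**  For every `k ≥ 1` there is a
U(1)-valued bond field `V` on `ℤ²` (`V(x, x+e₀) = 1`, `V(x, x+e₁) = u^{x₀}`, `u = e^{iπ∕k²}`) with every bond variable of modulus one and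
EVERY plaquette variable within `π∕k²` of `1` — the analogue of (3.47) with `2δ(L^jη)² := π∕k²` — such that for EVERY `U1`-valued lattice
gauge function `g` (the H-valued gauge functions of the ENDs' `hF`) some bond `⟨x, x+e_μ⟩` with `x` in the square `[0,k]²` has
`‖V^g(x, x+e_μ) − 1‖ ≥ 1∕(2k)`: the gauge-invariant holonomy around `∂[0,k]²` is `u^{k²} = e^{iπ} = −1`, at distance `2` from `1`, and it is a
product of `4k` gauge-transformed bond variables of modulus one, so they cannot all be within `1∕(2k)` of `1`.  Hence no constant C with
«curvature ≤ θ on the cube ⇒ some gauge representative is bondwise within C·θ of 1 on the cube» exists uniformly in the cube size: at side k,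
C ≥ (1∕(2k))∕(π∕k²) = k∕(2π).  In Erice's □₂ (side 3M₁(j), M₁(j) = [20κ⁻¹q(1,L^jη)] → ∞ as L^jη → 0) this is the logarithm of (3.49) ∕ (3.52);
the Ψ-road ENDs' no-log pre-gauge binder `h352''` is therefore NOT a consequence of (3.47). [folklore] -/
theorem curvature_small_no_bondwise_gauge (k : ℕ) (hk : 1 ≤ k) :
    ∃ V : Site 2 → Fin 2 → ℂˣ, (∀ x μ, ‖(V x μ : ℂ)‖ = 1) ∧
      (∀ (x : Site 2) (κ μ : Fin 2), κ ≠ μ → ‖((hol V x (plaqWord κ μ) : ℂˣ) : ℂ) - 1‖ ≤ Real.pi / (k : ℝ) ^ 2) ∧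
      ∀ g : Site 2 → ℂˣ, (∀ x, g x ∈ U1 ℂ) →
        ∃ (x : Site 2) (μ : Fin 2), (∀ i, 0 ≤ x i ∧ x i ≤ k) ∧ 1 / (2 * (k : ℝ)) ≤ ‖((gaugeAct g V x μ : ℂˣ) : ℂ) - 1‖ := by
  have hk0 : (k : ℝ) ≠ 0 := by exact_mod_cast (Nat.one_le_iff_ne_zero.mp hk)
  have hkpos : (0 : ℝ) < k := by exact_mod_cast hk
  -- the phase u = e^{iθ}, θ = π/k²
  set θ : ℝ := Real.pi / (k : ℝ) ^ 2 with hθ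
  have hθpos : 0 < θ := div_pos Real.pi_pos (by positivity)
  set uc : ℂ := Complex.exp (Complex.I * θ) with huc
  have huc1 : ‖uc‖ = 1 := Complex.norm_exp_I_mul_ofReal θ
  have huc0 : uc ≠ 0 := Complex.exp_ne_zero _
  set u : ℂˣ := Units.mk0 uc huc0 with hu
  have hu_val : (u : ℂ) = uc := rfl
  have hu_sub : ‖(u : ℂ) - 1‖ ≤ θ := by
    rw [hu_val, huc]
    simpa [Real.norm_eq_abs, abs_of_pos hθpos] using (Real.norm_exp_I_mul_ofReal_sub_one_le (x := θ))
  have hu_mem : u ∈ U1 ℂ := mem_U1_of_norm_eq_one (by rw [hu_val, huc1])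
  have hupow : ∀ n : ℤ, ‖((u ^ n : ℂˣ) : ℂ)‖ = 1 := fun n => by
    rw [Units.val_zpow_eq_zpow_val, norm_zpow, hu_val, huc1, one_zpow]
  -- u^{k²} = e^{iπ} = −1
  have hkC : (k : ℂ) ≠ 0 := Nat.cast_ne_zero.mpr (Nat.one_le_iff_ne_zero.mp hk)
  have hukk : ((u ^ ((k : ℤ) * k) : ℂˣ) : ℂ) = -1 := by
    rw [show ((k : ℤ) * k) = ((k * k : ℕ) : ℤ) by push_cast; ring, zpow_natCast, Units.val_pow_eq_pow_val, hu_val, huc,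
      ← Complex.exp_nat_mul, ← Complex.exp_pi_mul_I]
    congr 1
    rw [hθ]
    push_cast
    field_simp
  -- the configuration
  refine ⟨fun x μ => if μ = 0 then 1 else u ^ (x 0), fun x μ => ?_, fun x κ μ hκμ => ?_, fun g hg => ?_⟩
  · by_cases hμ : μ = 0
    · simp [hμ]
    · simp only [hμ, ↓reduceIte]; exact hupow _
  · -- plaquettes: u or u⁻¹
    have e00 : ∀ z : Site 2, ((z + e (0 : Fin 2) : Site 2) (0 : Fin 2)) = z 0 + 1 := fun z => by simp [e_apply]
    rw [hol_plaqWord_eq]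
    fin_cases κ <;> fin_cases μ
    · exact absurd rfl hκμ
    · simp only [Fin.zero_eta, Fin.isValue, ↓reduceIte, Fin.mk_one, one_ne_zero, one_mul, inv_one, mul_one, e00]
      rw [show u ^ (x 0 + 1) * (u ^ x 0)⁻¹ = u by group]
      exact hu_sub
    · simp only [Fin.mk_one, Fin.isValue, one_ne_zero, ↓reduceIte, Fin.zero_eta, mul_one, e00, inv_one]
      rw [show u ^ x 0 * (u ^ (x 0 + 1))⁻¹ = u⁻¹ by group]
      exact (norm_inv_sub_one_le hu_mem).trans hu_sub
    · exact absurd rfl hκμ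
  · -- the square [0,k]²: holonomy −1 against 4k bonds within 1/(2k)
    set V : Site 2 → Fin 2 → ℂˣ := fun x μ => if μ = 0 then 1 else u ^ (x 0) with hV
    have hVmem : ∀ x μ, V x μ ∈ U1 ℂ := fun x μ => by
      by_cases hμ : μ = 0
      · simp [hV, hμ, (U1 ℂ).one_mem]
      · simp only [hV, hμ, ↓reduceIte]; exact mem_U1_of_norm_eq_one (hupow _)
    set W := gaugeAct g V with hW
    have hWmem : ∀ x μ, W x μ ∈ U1 ℂ := gaugeAct_mem hVmem hg
    by_contra hcon
    push Not at hcon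
    -- hcon : ∀ x μ, (∀ i, 0 ≤ x i ∧ x i ≤ k) → ‖W x μ − 1‖ < 1/(2k)
    -- the holonomy of W around ∂[0,k]² is that of V, which is u^{k²} = −1
    have hholV : hol V 0 (rectWord k k (0 : Fin 2) 1) = u ^ ((k : ℤ) * k) := by
      rw [hol_rectWord_eq]
      have h1 : ∀ i ∈ Finset.range k, V ((0 : Site 2) + (i : ℤ) • e 0) 0 = 1 := fun i _ => by simp [hV]
      have h2 : ∀ j ∈ Finset.range k, V ((0 : Site 2) + (k : ℤ) • e 0 + (j : ℤ) • e 1) 1 = u ^ (k : ℤ) := fun j _ => by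
        simp [hV, e_apply]
      have h3 : ∀ i ∈ Finset.range k, V ((0 : Site 2) + (i : ℤ) • e 0 + (k : ℤ) • e 1) 0 = 1 := fun i _ => by simp [hV]
      have h4 : ∀ j ∈ Finset.range k, V ((0 : Site 2) + (j : ℤ) • e 1) 1 = 1 := fun j _ => by simp [hV, e_apply]
      rw [Finset.prod_congr rfl h1, Finset.prod_congr rfl h2, Finset.prod_congr rfl h3, Finset.prod_congr rfl h4]
      simp only [Finset.prod_const_one, Finset.prod_const, Finset.card_range, one_mul, inv_one, mul_one]
      rw [← zpow_natCast, ← zpow_mul]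
    have hholW : ((hol W 0 (rectWord k k (0 : Fin 2) 1) : ℂˣ) : ℂ) = -1 := by
      rw [hW, hol_rectWord_gaugeAct, hholV, hukk]
    -- the same holonomy as a product of 4k bond variables of W, each within 1/(2k) of 1
    have hsq : ∀ (a b : ℕ), a ≤ k → b ≤ k → ∀ i : Fin 2, 0 ≤ ((a : ℤ) • e (0 : Fin 2) + (b : ℤ) • e 1 : Site 2) i ∧
        ((a : ℤ) • e (0 : Fin 2) + (b : ℤ) • e 1 : Site 2) i ≤ k := by
      intro a b ha hb i
      fin_cases i <;> simp [e_apply, ha, hb]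
    have hside : ∀ (f : ℕ → ℂˣ), (∀ i, f i ∈ U1 ℂ) → (∀ i < k, ‖(f i : ℂ) - 1‖ < 1 / (2 * (k : ℝ))) →
        ‖((∏ i ∈ Finset.range k, f i : ℂˣ) : ℂ) - 1‖ < 1 / 2 := by
      intro f hf hlt
      refine (norm_prod_sub_one_le_sum f hf k).trans_lt ?_
      calc ∑ i ∈ Finset.range k, ‖(f i : ℂ) - 1‖ < ∑ _i ∈ Finset.range k, 1 / (2 * (k : ℝ)) :=
            Finset.sum_lt_sum_of_nonempty (Finset.nonempty_range_iff.mpr (Nat.one_le_iff_ne_zero.mp hk))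
              fun i hi => hlt i (Finset.mem_range.mp hi)
        _ = 1 / 2 := by rw [Finset.sum_const, Finset.card_range, nsmul_eq_mul]; field_simp
    -- the four sides (base point 0; corners (i,0), (k,j), (i,k), (0,j))
    have hA : ‖((∏ i ∈ Finset.range k, W ((0 : Site 2) + (i : ℤ) • e 0) 0 : ℂˣ) : ℂ) - 1‖ < 1 / 2 :=
      hside (fun i => W ((0 : Site 2) + (i : ℤ) • e 0) 0) (fun i => hWmem _ _) fun i hi => by
        have := hcon ((0 : Site 2) + (i : ℤ) • e 0) 0 (by simpa using hsq i 0 hi.le (Nat.zero_le k))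
        simpa using this
    have hB : ‖((∏ j ∈ Finset.range k, W ((0 : Site 2) + (k : ℤ) • e 0 + (j : ℤ) • e 1) 1 : ℂˣ) : ℂ) - 1‖ < 1 / 2 :=
      hside (fun j => W ((0 : Site 2) + (k : ℤ) • e 0 + (j : ℤ) • e 1) 1) (fun j => hWmem _ _) fun j hj => by
        have := hcon ((0 : Site 2) + (k : ℤ) • e 0 + (j : ℤ) • e 1) 1 (by simpa using hsq k j le_rfl hj.le)
        simpa using this
    have hC : ‖((∏ i ∈ Finset.range k, W ((0 : Site 2) + (i : ℤ) • e 0 + (k : ℤ) • e 1) 0 : ℂˣ) : ℂ) - 1‖ < 1 / 2 :=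
      hside (fun i => W ((0 : Site 2) + (i : ℤ) • e 0 + (k : ℤ) • e 1) 0) (fun i => hWmem _ _) fun i hi => by
        have := hcon ((0 : Site 2) + (i : ℤ) • e 0 + (k : ℤ) • e 1) 0 (by simpa using hsq i k hi.le le_rfl)
        simpa using this
    have hD : ‖((∏ j ∈ Finset.range k, W ((0 : Site 2) + (j : ℤ) • e 1) 1 : ℂˣ) : ℂ) - 1‖ < 1 / 2 :=
      hside (fun j => W ((0 : Site 2) + (j : ℤ) • e 1) 1) (fun j => hWmem _ _) fun j hj => by
        have := hcon ((0 : Site 2) + (j : ℤ) • e 1) 1 (by simpa using hsq 0 j (Nat.zero_le k) hj.le)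
        simpa using this
    -- assemble: ‖A·B·C⁻¹·D⁻¹ − 1‖ < 2 = ‖−1 − 1‖
    set A := ∏ i ∈ Finset.range k, W ((0 : Site 2) + (i : ℤ) • e 0) 0 with hAdef
    set B := ∏ j ∈ Finset.range k, W ((0 : Site 2) + (k : ℤ) • e 0 + (j : ℤ) • e 1) 1 with hBdef
    set C := ∏ i ∈ Finset.range k, W ((0 : Site 2) + (i : ℤ) • e 0 + (k : ℤ) • e 1) 0 with hCdef
    set D := ∏ j ∈ Finset.range k, W ((0 : Site 2) + (j : ℤ) • e 1) 1 with hDdef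
    have hAm : A ∈ U1 ℂ := Subgroup.prod_mem _ fun _ _ => hWmem _ _
    have hBm : B ∈ U1 ℂ := Subgroup.prod_mem _ fun _ _ => hWmem _ _
    have hCm : C ∈ U1 ℂ := Subgroup.prod_mem _ fun _ _ => hWmem _ _
    have hDm : D ∈ U1 ℂ := Subgroup.prod_mem _ fun _ _ => hWmem _ _
    have hrect : hol W 0 (rectWord k k (0 : Fin 2) 1) = A * B * C⁻¹ * D⁻¹ := by
      rw [hol_rectWord_eq]
    have hbound : ‖((A * B * C⁻¹ * D⁻¹ : ℂˣ) : ℂ) - 1‖ < 2 := by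
      have h1 := norm_units_mul_sub_one_le (v := D⁻¹) ((U1 ℂ).mul_mem ((U1 ℂ).mul_mem hAm hBm) ((U1 ℂ).inv_mem hCm))
      have h2 := norm_units_mul_sub_one_le (v := C⁻¹) ((U1 ℂ).mul_mem hAm hBm)
      have h3 := norm_units_mul_sub_one_le (v := B) hAm
      have hCi := norm_inv_sub_one_le hCm
      have hDi := norm_inv_sub_one_le hDm
      linarith
    rw [← hrect, hholW] at hbound
    norm_num at hbound

/-- **Reading for the ENDs' pre-gauge binder: no uniform constant.**  There is no C such that, for all k ≥ 1 and every U(1)-field on ℤ² whose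
plaquettes are within θ of 1 (θ > 0), some U1-gauge representative is bondwise within C·θ of 1 on the square [0,k]²: the witness forces
C ≥ k∕(2π) for every k.  In Erice's letters (□₂ of side 3M₁(j), (3.47) ⇒ (3.49) ∕ (3.52)): the factor dist(⟨x,x′⟩, y) ≤ 3dM₁∕2 — the logarithm
q(1,L^jη) — cannot be removed from the bondwise size of any gauge representative of V′; a j-uniform `h352'' : ‖Bg_{j,X}‖ ≤ C₁″δ(L^jη)²` is an
extra premise on V′, located NOT-IN-PRINT. [folklore] -/
theorem no_uniform_pregauge_constant :
    ¬ ∃ C : ℝ, ∀ k : ℕ, 1 ≤ k → ∀ (θ : ℝ) (V : Site 2 → Fin 2 → ℂˣ), 0 < θ → (∀ x μ, ‖(V x μ : ℂ)‖ = 1) →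
      (∀ (x : Site 2) (κ μ : Fin 2), κ ≠ μ → ‖((hol V x (plaqWord κ μ) : ℂˣ) : ℂ) - 1‖ ≤ θ) →
      ∃ g : Site 2 → ℂˣ, (∀ x, g x ∈ U1 ℂ) ∧
        ∀ (x : Site 2) (μ : Fin 2), (∀ i, 0 ≤ x i ∧ x i ≤ k) → ‖((gaugeAct g V x μ : ℂˣ) : ℂ) - 1‖ < C * θ := by
  rintro ⟨C, hC⟩
  -- choose k with k/(2π) > C, i.e. C·(π/k²) < 1/(2k)
  obtain ⟨k, hk⟩ := exists_nat_gt (max 1 (2 * Real.pi * C))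
  have hk1 : 1 ≤ k := by
    have : (1 : ℝ) < k := (le_max_left _ _).trans_lt hk
    exact_mod_cast this.le
  have hkpos : (0 : ℝ) < k := by exact_mod_cast hk1
  obtain ⟨V, hV1, hplaq, hall⟩ := curvature_small_no_bondwise_gauge k hk1
  obtain ⟨g, hg, hsmall⟩ := hC k hk1 (Real.pi / (k : ℝ) ^ 2) V (div_pos Real.pi_pos (by positivity)) hV1 hplaq
  obtain ⟨x, μ, hx, hge⟩ := hall g hg
  have hlt := hsmall x μ hx
  -- C·π/k² < 1/(2k) since 2πC < k
  have hCk : C * (Real.pi / (k : ℝ) ^ 2) < 1 / (2 * (k : ℝ)) := by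
    have h2 : 2 * Real.pi * C < k := (le_max_right _ _).trans_lt hk
    rw [div_eq_mul_inv, lt_div_iff₀ (by positivity)]
    have hπ := Real.pi_pos
    calc C * (Real.pi * ((k : ℝ) ^ 2)⁻¹) * (2 * (k : ℝ)) = (2 * Real.pi * C) * ((k : ℝ) * ((k : ℝ) ^ 2)⁻¹ ) := by ring
      _ = (2 * Real.pi * C) / k := by field_simp
      _ < (k : ℝ) / k := by gcongr
      _ = 1 := div_self hkpos.ne'
  linarith

end Witness

end Summit.QuantumFields.BalabanUV.Beta.EricePreGauge347Witness
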